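import Summits.ResolutionOfSingularities.ResolutionOfSingularities.Theorems.MarkedTransferCampaignW46HostLadder
import Summits.ResolutionOfSingularities.ResolutionOfSingularities.Theorems.MarkedTransferCampaignW46HostCurves
import HarnessLib

/-!
# [OURS · L1 W4.6 rung (ii-1⁺)] CLOSER: `HypersurfaceOrderReductionDimLE p 1` (and `p 0`) — the host ladder's curve rung

Cell res-hironaka, LADDER-RESOLUTION rung L (D-0089), slot W4.6, rung (ii-1⁺) (res-L1-type-o1 RUNG MAP v1.1 NEXT (ii)); seat
res-L1-s46-pv-10 = res-D-pv-047. The typer's host ladder `CampaignW46.HypersurfaceOrderReductionDimLE p d` (`…HostLadder.lean`: the body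
of MarkedTransfer `HypersurfaceOrderReductionDimLeThree` stmt-ResolutionOfSingularities-16156 with `3 ↦ d`, `p` a parameter,
universe `0`) CLOSED BY NAME at `d = 1` (curves) from the universe-polymorphic theorem `hypersurfaceOrderReduction_of_dim_le_one`
(`…HostCurves.lean`, p500186), and at `d = 0` by antitonicity (`HypersurfaceOrderReductionDimLE.of_le`). Route-independent (no
`Theses/…` import; the identification with the route decl is the typer's calibration leaf). `--kind proof --supports
stmt-ResolutionOfSingularities-16156 --as helper`. Everything is OURS; nothing is a statement of the manuscript; no typed `Hironaka2017`
candidate or named FACT enters. AI-written; weaker than expert review.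
-/

noncomputable section

set_option linter.dupNamespace false -- mandated namespace of this single-conjunct summit

open CategoryTheory AlgebraicGeometry TopologicalSpace

namespace Summit.ResolutionOfSingularities.ResolutionOfSingularities.Theorems

namespace CampaignW46

open Literature.AlgebraicGeometry.Resolution

/-- **THE CURVE RUNG OF THE HOST LADDER, PROVED**: `HypersurfaceOrderReductionDimLE p 1` — for every prime `p`, perfect field `k` of
characteristic `p`, separated finite-type quasi-compact integral regular `k`-scheme `X` of `topologicalKrullDim ≤ 1`, effective Cartier
`I ≠ ⊥`, snc boundary `E` and `m ≥ 1`, the marked ideal `(I, E, m)` has a BGMW marked resolution (by `hypersurfaceOrderReduction_of_dim_le_one`;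
the characteristic, perfectness, separatedness and Cartier binders are unused). A partial result on the host item stmt-16156 itself
(its `d ≤ 1` slice); nothing about `d = 2, 3`. [cite: BierstoneGrigorievMilmanWlodarczyk2011, Def. 3.1.3] -/
theorem hypersurfaceOrderReductionDimLE_one (p : ℕ) : HypersurfaceOrderReductionDimLE p 1 := by
  intro _ k _ _ _ X s _ hloft hqc hint hreg hdim I hI _ E hE m hm
  haveI := hloft
  haveI := hqc
  haveI := hint
  exact hypersurfaceOrderReduction_of_dim_le_one X s hreg (by exact_mod_cast hdim) I hI E hE m hm

/-- The warm-up slice `d = 0` of the host ladder, from `d = 1` by antitonicity. [folklore] -/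
theorem hypersurfaceOrderReductionDimLE_zero (p : ℕ) : HypersurfaceOrderReductionDimLE p 0 :=
  HypersurfaceOrderReductionDimLE.of_le (Nat.zero_le 1) (hypersurfaceOrderReductionDimLE_one p)

/-- Consequently the Γ-free ladder rungs `d ≤ 1` also follow from the host ladder (consistency check with p497830 through the
typer's `gammaFreeGlobalDimLE_of_host`; the direct proofs are `gammaFreeGlobalDimLE_one/_zero`). [folklore] -/
theorem gammaFreeGlobalDimLE_one_of_host (p : ℕ) : GammaFreeGlobalOrderReductionDimLE.{0} p 1 :=
  gammaFreeGlobalDimLE_of_host (hypersurfaceOrderReductionDimLE_one p)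

end CampaignW46

end Summit.ResolutionOfSingularities.ResolutionOfSingularities.Theorems

end
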